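import Summits.CriticalPhenomena.CardyFormulaZ2.Theorems.CardyWhiteToColouredSimilarityUpgradeStubDualSum
import Summits.CriticalPhenomena.CardyFormulaZ2.Theorems.CardyWhiteToColouredSimilarityUpgradeStubLimitDuality
import Summits.CriticalPhenomena.CardyFormulaZ2.Theorems.CardyAnchoredRigiditySubseqCardyJointLimitSymmetry

/-!
# Full limits of affinely antisymmetric conformal rectangles are `1/2`
# (crux `SimilarityUpgrade`, stmt-CriticalPhenomena-4597, line `registered`, lead c4 wave 2: stub `stub_symmetricHalfFull`)

Route `CardyWhiteToColoured`, sub-problem `CardyFormulaZ2`.  Let `Φ` be a FULL `δ → 0⁺` limit of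
the bond-`ℤ²` crossing probabilities `bondDomainCrossingProb` (G02 discretisation at `p = 1/2`),
and let the conformal rectangle `R = (Ω; a, b, c, d)` be invariant under an affine reflection
`σ z = u z̄ + v` of the plane along a lattice axis or diagonal (`u ∈ {±1, ±i}`, `v ∈ ℂ`) which
exchanges the two conjugate pairs of marked arcs (`σ(arc 0) = arc 1`, `σ(arc 2) = arc 3`, or
`σ(arc 0) = arc 3`, `σ(arc 2) = arc 1`).  Then `Φ R = 1/2`.

Proof.  Realise `σ` by a plane homeomorphism `T` written as a composite of the complex
conjugation, at most three quarter turns `z ↦ i z` and the translation by `v`; put `R' := T(R)`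
(`MarkedDomain.map`).  Then `R'` has the carrier of `R` and is marked by the conjugate pair of
arcs, so limit self-duality (`stub_dualSum`, Schramm–Smirnov / Grimmett §11) and `stub_limitDuality`
give `Φ R + Φ R' = 1`.  On the other hand a full limit is the joint sequential limit along the mesh
sequence `1/(n+1)`, hence invariant under conjugation and quarter turns (exact symmetries of the
discretisation, `JointLimit.map_conj`, `JointLimit.map_mul_I`) and under all translations
(`JointLimit.map_addLeft`, Schramm–Smirnov perturbation theory); by functoriality of
`MarkedDomain.map` (`MarkedDomain.map_map`) `Φ R' = Φ R`, whence `Φ R = 1/2`.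

References: S. Smirnov, *Critical percolation in the plane*, C. R. Acad. Sci. Paris 333 (2001) §2;
O. Schramm, S. Smirnov, Ann. Probab. 39 (2011) §1.3, §5; G. R. Grimmett, *Percolation* (1999)
§9.7, Lemma 11.21.
-/

noncomputable section

namespace Summit.CriticalPhenomena.CardyFormulaZ2.Cruxes.SimilarityUpgrade.Stubs

open Filter Topology Set MeasureTheory
open Literature.Probability.RandomPlanarGeometry
open Literature.Probability.Percolation
open Summit.CriticalPhenomena.CardyFormulaZ2.Cruxes.SubseqCardy.Birth

/-- A full `δ → 0⁺` limit of the crossing probabilities is in particular their joint sequential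
limit along the mesh sequence `1 / (n + 1) → 0⁺`. [folklore] -/
theorem symmetricHalfFull_jointLimit {Φ : ConformalRectangle → ℝ}
    (hΦ : ∀ R : ConformalRectangle, Tendsto (bondDomainCrossingProb R) (𝓝[>] (0 : ℝ)) (𝓝 (Φ R)))
    (R : ConformalRectangle) :
    Tendsto (fun n : ℕ => bondDomainCrossingProb R (1 / ((n : ℝ) + 1))) atTop (𝓝 (Φ R)) :=
  (hΦ R).comp (tendsto_nhdsWithin_iff.2 ⟨tendsto_one_div_add_atTop_nhds_zero_nat,
    Eventually.of_forall fun n => mem_Ioi.2 (by positivity)⟩)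

/-- Full limits are invariant under complex conjugation of the rectangle (an exact symmetry of the
lattice `ℤ²` and of the discretisation). [folklore] -/
theorem symmetricHalfFull_map_conj {Φ : ConformalRectangle → ℝ}
    (hΦ : ∀ R : ConformalRectangle, Tendsto (bondDomainCrossingProb R) (𝓝[>] (0 : ℝ)) (𝓝 (Φ R)))
    (R : ConformalRectangle) : Φ (R.map Complex.conjCLE.toHomeomorph) = Φ R :=
  JointLimit.map_conj (symmetricHalfFull_jointLimit hΦ) _ (fun _ => rfl) R

/-- Full limits are invariant under the quarter turn `z ↦ i z` of the rectangle (an exact symmetry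
of the lattice `ℤ²` and of the discretisation). [folklore] -/
theorem symmetricHalfFull_map_mulI {Φ : ConformalRectangle → ℝ}
    (hΦ : ∀ R : ConformalRectangle, Tendsto (bondDomainCrossingProb R) (𝓝[>] (0 : ℝ)) (𝓝 (Φ R)))
    (R : ConformalRectangle) :
    Φ (R.map (Homeomorph.mulLeft₀ Complex.I Complex.I_ne_zero)) = Φ R :=
  JointLimit.map_mul_I (symmetricHalfFull_jointLimit hΦ) _ (fun _ => rfl) R

/-- Full limits are invariant under every translation of the rectangle (Schramm–Smirnov
perturbation theory absorbs the sub-mesh part of the translation). [folklore] -/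
theorem symmetricHalfFull_map_addLeft {Φ : ConformalRectangle → ℝ}
    (hΦ : ∀ R : ConformalRectangle, Tendsto (bondDomainCrossingProb R) (𝓝[>] (0 : ℝ)) (𝓝 (Φ R)))
    (R : ConformalRectangle) (e : ℂ) : Φ (R.map (Homeomorph.addLeft e)) = Φ R :=
  JointLimit.map_addLeft (u := fun n : ℕ => 1 / ((n : ℝ) + 1))
    (tendsto_nhdsWithin_iff.2 ⟨tendsto_one_div_add_atTop_nhds_zero_nat,
      Eventually.of_forall fun n => mem_Ioi.2 (by positivity)⟩)
    (symmetricHalfFull_jointLimit hΦ) R e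

/-- For `u ∈ {±1, ±i}` and `v ∈ ℂ` the affine reflection `z ↦ u z̄ + v` is realised by a plane
homeomorphism leaving every full limit invariant: the composite of the conjugation, at most three
quarter turns and the translation by `v`. [folklore] -/
theorem symmetricHalfFull_exists_homeomorph {Φ : ConformalRectangle → ℝ}
    (hΦ : ∀ R : ConformalRectangle, Tendsto (bondDomainCrossingProb R) (𝓝[>] (0 : ℝ)) (𝓝 (Φ R)))
    (u v : ℂ) (hu : u = 1 ∨ u = -1 ∨ u = Complex.I ∨ u = -Complex.I) :
    ∃ T : ℂ ≃ₜ ℂ, (∀ z, T z = u * (starRingEnd ℂ) z + v) ∧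
      ∀ R : ConformalRectangle, Φ (R.map T) = Φ R := by
  have hc := symmetricHalfFull_map_conj hΦ
  have hI := symmetricHalfFull_map_mulI hΦ
  have hv := symmetricHalfFull_map_addLeft hΦ
  have hCz : ∀ z : ℂ, Complex.conjCLE.toHomeomorph z = (starRingEnd ℂ) z := fun _ => rfl
  have hJz : ∀ z : ℂ, Homeomorph.mulLeft₀ Complex.I Complex.I_ne_zero z = Complex.I * z :=
    fun _ => rfl
  have hVz : ∀ z : ℂ, Homeomorph.addLeft v z = v + z := fun _ => rfl
  rcases hu with rfl | rfl | rfl | rfl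
  · refine ⟨Complex.conjCLE.toHomeomorph.trans (Homeomorph.addLeft v), fun z => ?_, fun R => ?_⟩
    · rw [Homeomorph.trans_apply, hVz, hCz]
      ring
    · rw [← MarkedDomain.map_map, hv, hc]
  · refine ⟨((Complex.conjCLE.toHomeomorph.trans
        (Homeomorph.mulLeft₀ Complex.I Complex.I_ne_zero)).trans
        (Homeomorph.mulLeft₀ Complex.I Complex.I_ne_zero)).trans (Homeomorph.addLeft v),
      fun z => ?_, fun R => ?_⟩
    · rw [Homeomorph.trans_apply, Homeomorph.trans_apply, Homeomorph.trans_apply, hVz, hJz, hJz,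
        hCz, ← mul_assoc, Complex.I_mul_I]
      ring
    · rw [← MarkedDomain.map_map, ← MarkedDomain.map_map, ← MarkedDomain.map_map, hv, hI, hI, hc]
  · refine ⟨(Complex.conjCLE.toHomeomorph.trans
        (Homeomorph.mulLeft₀ Complex.I Complex.I_ne_zero)).trans (Homeomorph.addLeft v),
      fun z => ?_, fun R => ?_⟩
    · rw [Homeomorph.trans_apply, Homeomorph.trans_apply, hVz, hJz, hCz]
      ring
    · rw [← MarkedDomain.map_map, ← MarkedDomain.map_map, hv, hI, hc]
  · refine ⟨(((Complex.conjCLE.toHomeomorph.trans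
        (Homeomorph.mulLeft₀ Complex.I Complex.I_ne_zero)).trans
        (Homeomorph.mulLeft₀ Complex.I Complex.I_ne_zero)).trans
        (Homeomorph.mulLeft₀ Complex.I Complex.I_ne_zero)).trans (Homeomorph.addLeft v),
      fun z => ?_, fun R => ?_⟩
    · rw [Homeomorph.trans_apply, Homeomorph.trans_apply, Homeomorph.trans_apply,
        Homeomorph.trans_apply, hVz, hJz, hJz, hJz, hCz, ← mul_assoc, Complex.I_mul_I]
      ring
    · rw [← MarkedDomain.map_map, ← MarkedDomain.map_map, ← MarkedDomain.map_map,
        ← MarkedDomain.map_map, hv, hI, hI, hI, hc]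

/-- **Full limits of affinely antisymmetric conformal rectangles are `1/2`** (stub
`stub_symmetricHalfFull` of the `SimilarityUpgrade` crux).  If `Φ` is the full `δ → 0⁺` limit of
the bond-`ℤ²` crossing probabilities and the conformal rectangle `R` is mapped to itself, with its
two conjugate pairs of marked arcs exchanged, by an affine reflection `z ↦ u z̄ + v` along a lattice
axis or diagonal (`u ∈ {±1, ±i}`), then `Φ R = 1/2`: limit self-duality gives `Φ R + Φ (σR) = 1`
and lattice symmetry plus translation invariance of full limits give `Φ (σR) = Φ R`. [folklore] -/
theorem stub_symmetricHalfFull :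
    ∀ Φ : ConformalRectangle → ℝ,
      (∀ R : ConformalRectangle, Tendsto (bondDomainCrossingProb R) (𝓝[>] (0 : ℝ)) (𝓝 (Φ R))) →
      ∀ (R : ConformalRectangle) (u v : ℂ), (u = 1 ∨ u = -1 ∨ u = Complex.I ∨ u = -Complex.I) →
        (fun z : ℂ => u * (starRingEnd ℂ) z + v) '' R.carrier = R.carrier →
        ((fun z : ℂ => u * (starRingEnd ℂ) z + v) '' R.arc 0 = R.arc 1 ∧
            (fun z : ℂ => u * (starRingEnd ℂ) z + v) '' R.arc 2 = R.arc 3 ∨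
          (fun z : ℂ => u * (starRingEnd ℂ) z + v) '' R.arc 0 = R.arc 3 ∧
            (fun z : ℂ => u * (starRingEnd ℂ) z + v) '' R.arc 2 = R.arc 1) →
        Φ R = 1 / 2 := by
  intro Φ hΦ R u v hu hcar harcs
  obtain ⟨T, hT, hinv⟩ := symmetricHalfFull_exists_homeomorph hΦ u v hu
  -- `T` and `σ` have the same images
  have himg : ∀ X : Set ℂ, T '' X = (fun z : ℂ => u * (starRingEnd ℂ) z + v) '' X :=
    fun X => image_congr fun z _ => hT z
  -- the reflected rectangle `R' := T(R)`: same carrier, conjugate marking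
  have hcar' : (R.map T).carrier = R.carrier := by
    rw [MarkedDomain.carrier_map, himg, hcar]
  have harcs' : (R.map T).arc 0 = R.arc 1 ∧ (R.map T).arc 2 = R.arc 3 ∨
      (R.map T).arc 0 = R.arc 3 ∧ (R.map T).arc 2 = R.arc 1 := by
    simp only [MarkedDomain.arc_map, himg]
    exact harcs
  -- limit duality `Φ R + Φ R' = 1` and invariance `Φ R' = Φ R`
  have hsum := stub_limitDuality stub_dualSum Φ hΦ R (R.map T) hcar' harcs'
  rw [hinv] at hsum
  linarith

end Summit.CriticalPhenomena.CardyFormulaZ2.Cruxes.SimilarityUpgrade.Stubs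

end
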